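import Mathlib
import Literature.Computability.Complexity.MatchingExtensionComplexityHolds
import Summits.PneNP.PneNP.Theorems.ConvexRankGatesConvexGateBlindMatchingCore

/-!
# Crux `ConvexGateBlind` (stmt-PneNP-10680): the perfect-matching core — its LP unit level is Rothvoss's theorem

Helpers (`--supports stmt-PneNP-10680`; prover seat 2, session 27), sequel of `…MatchingCore`. The one stub of the
matching line (`convexGateBlind_of_pm_hard`: ε-uniform hybrid hardness of the shifted odd-cut crossing matrices
`(|M ∩ δ(U)| − ε)` of `K_{2h}`) is calibrated here at its `ε = 1`, `q = 0` corner: `PMConeFact (2h) 0 r 1` is literally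
a non-negative rank-`r` factorisation of Rothvoss's odd-cut slack matrix, so Rothvoss's theorem — kernel-checked in
the tree (`Literature.Computability.Complexity.rothvoss_matching_slack_bound_holds`) — refutes it for
`r ≤ 2^{c₀·2h}` (`not_pmConeFact_unit`), and through the padding numerics of `…MatchingCore` the LP unit level of
the canonical family of the crux holds at EVERY exponent `δ ∈ (0, 1/2]` unconditionally (`lp_unit_level_of_delta`;
the tree's `unitPotentialHard_lp` is `δ = 1/2`). What lies beyond print: fixed shifts `ε < 1 − λ₀` (Braun–Pokutta
2015 give `(1 − λ₀, 1]`), the limit `ε → 0⁺` (`sep₊(PERFECT-MATCHING)`), and every PSD level (`q > 0`; the unit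
level contains the SDP extension complexity of the perfect matching polytope). [cite: Rothvoss2017, Thm. 1]
-/

set_option linter.dupNamespace false -- `Summit.PneNP.PneNP.…`: summit = sub-problem (D-0017)

noncomputable section

/-! ## The LP unit level of the stub is Rothvoss's theorem (unconditional, every `δ ≤ 1/2`) -/

namespace Summit.PneNP.PneNP.Cruxes.ConvexGateBlind.StrictRankConicCover

open Matrix Finset Filter Literature.Computability.Complexity

/-- **Unit level of the stub, LP part** (Rothvoss 2017, Thm. 1, kernel-checked in the tree as
`rothvoss_matching_slack_bound_holds`): there is `c₀ > 0` with, eventually in `h`, `¬ PMConeFact (2h) 0 r 1` for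
every `r ≤ 2^{c₀ · 2h}` — `PMConeFact n 0 r 1` is literally a non-negative rank-`r` factorisation of the odd-cut
slack matrix. [cite: Rothvoss2017, Thm. 1] -/
theorem not_pmConeFact_unit :
    ∃ c₀ : ℝ, 0 < c₀ ∧ ∀ᶠ h : ℕ in atTop, ∀ r : ℕ, (r : ℝ) ≤ 2 ^ (c₀ * ((2 * h : ℕ) : ℝ)) →
      ¬ PMConeFact (2 * h) 0 r 1 := by
  obtain ⟨c₀, hc₀, hev⟩ := Literature.Computability.Complexity.rothvoss_matching_slack_bound_holds
  refine ⟨c₀, hc₀, ?_⟩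
  have h2 : Tendsto (fun h : ℕ => 2 * h) atTop atTop :=
    tendsto_atTop_atTop.2 fun b => ⟨b, fun h hh => by omega⟩
  filter_upwards [h2.eventually hev] with h hh
  intro r hr hf
  obtain ⟨H, Y, a, b, -, -, ha, hb, hfact⟩ := hf
  refine hh (even_two_mul h) r hr a b ha hb fun U M hU hM => ?_
  have := hfact U M hU hM
  have htr : (H U * Y M).trace = 0 := by simp [Matrix.trace]
  rwa [htr, zero_add] at this

/-- Numerics of the size budget at the unit level: eventually `m^c ≤ 2^{c₀ · 2h}` for `h = ⌊(⌈m^δ⌉₊ - 2)/2⌋`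
(`2h ≥ m^δ - 3` and `log m = o(m^δ)`). [folklore] -/
theorem eventually_pow_le_two_rpow_delta (c : ℕ) {c₀ δ : ℝ} (hc₀ : 0 < c₀) (hδ : 0 < δ) :
    ∀ᶠ m : ℕ in atTop,
      ((m ^ c : ℕ) : ℝ) ≤ (2 : ℝ) ^ (c₀ * ((2 * ((⌈(m : ℝ) ^ δ⌉₊ - 2) / 2) : ℕ) : ℝ)) := by
  have hpow : Tendsto (fun m : ℕ => (m : ℝ) ^ δ) atTop atTop :=
    (tendsto_rpow_atTop hδ).comp tendsto_natCast_atTop_atTop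
  set η : ℝ := c₀ * Real.log 2 / (2 * (c + 1)) with hη
  have hlog2 : 0 < Real.log 2 := Real.log_pos (by norm_num)
  have hc1 : (0 : ℝ) < c + 1 := by positivity
  have hηpos : 0 < η := by positivity
  have hlo := (isLittleO_log_rpow_atTop hδ).bound hηpos
  have hlo' : ∀ᶠ m : ℕ in atTop, ‖Real.log m‖ ≤ η * ‖(m : ℝ) ^ δ‖ :=
    tendsto_natCast_atTop_atTop.eventually hlo
  filter_upwards [hlo', hpow.eventually_ge_atTop 6, eventually_ge_atTop 1] with m hlog hx6 hm1
  set x : ℝ := (m : ℝ) ^ δ with hx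
  set k : ℕ := ⌈(m : ℝ) ^ δ⌉₊ with hk
  set h : ℕ := (k - 2) / 2 with hh
  have hmpos : (0 : ℝ) < m := by exact_mod_cast hm1
  have hx0 : (0 : ℝ) ≤ x := by positivity
  have hkge : x ≤ k := Nat.le_ceil _
  have h2h : k ≤ 2 * h + 3 := by omega
  have h2hr : x - 3 ≤ ((2 * h : ℕ) : ℝ) := by
    have : (k : ℝ) ≤ ((2 * h : ℕ) : ℝ) + 3 := by exact_mod_cast h2h
    linarith
  have hlogm : Real.log m ≤ η * x := by
    have h1 : Real.log m ≤ ‖Real.log m‖ := Real.le_norm_self _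
    rw [Real.norm_of_nonneg hx0] at hlog
    exact h1.trans hlog
  have hmain : (c : ℝ) * Real.log m ≤ Real.log 2 * (c₀ * ((2 * h : ℕ) : ℝ)) := by
    have hc0 : (0 : ℝ) ≤ c := Nat.cast_nonneg c
    have step1 : (c : ℝ) * Real.log m ≤ c * (η * x) := mul_le_mul_of_nonneg_left hlogm hc0
    have step2 : (c : ℝ) * η ≤ c₀ * Real.log 2 / 2 := by
      rw [hη, show (c : ℝ) * (c₀ * Real.log 2 / (2 * (c + 1))) = c₀ * Real.log 2 / 2 * (c / (c + 1)) by
        field_simp]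
      have : (c : ℝ) / (c + 1) ≤ 1 := (div_le_one hc1).2 (by linarith)
      have hpos : 0 ≤ c₀ * Real.log 2 / 2 := by positivity
      nlinarith
    have step3 : c₀ * Real.log 2 / 2 * x ≤ Real.log 2 * (c₀ * ((2 * h : ℕ) : ℝ)) := by
      have : x / 2 ≤ x - 3 := by linarith
      have hpos : 0 ≤ c₀ * Real.log 2 := by positivity
      nlinarith [h2hr]
    calc (c : ℝ) * Real.log m ≤ c * (η * x) := step1
      _ = (c * η) * x := by ring
      _ ≤ c₀ * Real.log 2 / 2 * x := mul_le_mul_of_nonneg_right step2 hx0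
      _ ≤ Real.log 2 * (c₀ * ((2 * h : ℕ) : ℝ)) := step3
  have hl : ((m ^ c : ℕ) : ℝ) = Real.exp ((c : ℝ) * Real.log m) := by
    rw [Nat.cast_pow, ← Real.rpow_natCast, Real.rpow_def_of_pos hmpos, mul_comm]
  have hr : (2 : ℝ) ^ (c₀ * ((2 * h : ℕ) : ℝ)) = Real.exp (Real.log 2 * (c₀ * ((2 * h : ℕ) : ℝ))) :=
    Real.rpow_def_of_pos (by norm_num) _
  rw [hl, hr, Real.exp_le_exp]
  exact hmain

/-- **The LP unit level of the canonical family at every `δ ∈ (0, 1/2]`, unconditionally**: for every `c`,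
eventually in `m`, `¬ ConeFactorisable m ⌈m^δ⌉₊ 0 r 1 1` for `r ≤ m^c` (the tree's `unitPotentialHard_lp` is the case
`δ = 1/2`; here the padding of §2 places the minor at every smaller exponent — the `ε = 1` endpoint of the line's
stub, LP part, via `not_pmConeFact_unit`). [cite: Rothvoss2017, Thm. 1] -/
theorem lp_unit_level_of_delta :
    ∀ {δ : ℝ}, 0 < δ → δ ≤ 1 / 2 → ∀ c : ℕ, ∀ᶠ m : ℕ in atTop, ∀ r : ℕ, r ≤ m ^ c →
      ¬ ConeFactorisable m ⌈(m : ℝ) ^ δ⌉₊ 0 r (fun _ => 1) (fun _ => 1) := by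
  intro δ hδ hδ2
  obtain ⟨c₀, hc₀, hev⟩ := not_pmConeFact_unit
  intro c
  have hpow : Tendsto (fun m : ℕ => (m : ℝ) ^ δ) atTop atTop :=
    (tendsto_rpow_atTop hδ).comp tendsto_natCast_atTop_atTop
  have hceil : Tendsto (fun m : ℕ => ⌈(m : ℝ) ^ δ⌉₊) atTop atTop := tendsto_nat_ceil_atTop.comp hpow
  have hhalf : Tendsto (fun k : ℕ => (k - 2) / 2) atTop atTop :=
    tendsto_atTop_atTop.2 fun b => ⟨2 * b + 2, fun k hk => by omega⟩
  have hH : Tendsto (fun m : ℕ => (⌈(m : ℝ) ^ δ⌉₊ - 2) / 2) atTop atTop := hhalf.comp hceil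
  filter_upwards [hH.eventually hev, eventually_pm_fits hδ hδ2, eventually_pow_le_two_rpow_delta c hc₀ hδ]
    with m hPMm hfit hsize
  obtain ⟨hk8, -, hfit⟩ := hfit
  intro r hr hf
  set k : ℕ := ⌈(m : ℝ) ^ δ⌉₊ with hk
  set h : ℕ := (k - 2) / 2 with hh
  have hh1 : 1 ≤ h := by omega
  have hkp : h + 1 + (k - (h + 1)) = k := by omega
  rw [← hkp] at hf
  have hrr : (r : ℝ) ≤ 2 ^ (c₀ * ((2 * h : ℕ) : ℝ)) :=
    le_trans (by exact_mod_cast hr) hsize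
  exact hPMm r hrr (pmConeFact_of_coneFactorisable_pad hh1 hfit hf)

end Summit.PneNP.PneNP.Cruxes.ConvexGateBlind.StrictRankConicCover

end
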